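import Summits.BirchSwinnertonDyer.BirchSwinnertonDyer.Theorems.BiquadraticEisensteinDescentHeegnerTwistCouplingInSupplyKrizLiCornerQT27
import Summits.BirchSwinnertonDyer.BirchSwinnertonDyer.Theorems.PrintCFramJZeroThreeUnitRegimePrimePairInstances
import Literature.NumberTheory.QuadraticFields.ImaginaryQuadraticClassNumberValues
import HarnessLib

set_option linter.dupNamespace false -- `Summit.BirchSwinnertonDyer.BirchSwinnertonDyer.Theorems.…` (summit = sub, D-0017)
set_option autoImplicit false

/-!
# Crux `HeegnerTwistCouplingInSupply` (stmt-BirchSwinnertonDyer-21381) — QT27₊ through the Kriz–Li door, II: KERNEL INSTANCES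
# for the KL3-regular primes `q ≡ 5 (mod 12)` below `110`: `(q, r) = (5, 11), (17, 47), (41, 23), (53, 11), (89, 11), (101, 23)`

Route `BiquadraticEisensteinDescent` (cell `pub/bsd-wall`, width seat `bsd-wall-cm-bed-w4` g27; `--supports` 21381, helper).
Companion of `…KrizLiCornerQT27.lean` (`exists_cruxConclusion_of_prime_pair`). For each KL3-regular prime `q ≡ 5 (mod 12)` below
`110` (`q = 29` is irregular: `h(−87) = 6`) ONE prime `r ≡ 11 (mod 12)` with `(−r/q) = +1`, `3 ∤ h(−qr)`, `h(−r) < q`, and the two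
integer certificates of Kriz–Li's Bernoulli hypothesis DECIDED in the kernel (`decide +kernel` on Euler's criterion in `ℕ`, the
`bsd-print-cfram` recipe `RouteU.jacobiSym_prime_eq_ite_nat`; for `(17, 47)`, `(41, 23)` and `S₂(5)` the certificates ARE that cell's
`PrintCFram.certOne_seventeen_fortySeven` / `certTwo_seventeen` / `certOne_fortyOne_twentyThree` / `certTwo_fortyOne` / `certTwo_five`, BY NAME):

| `q` | `r` | `h(−r)` | `S₁(q,r) = −qr·h(−qr)` | `S₂(q) = −3q·h(−3q)` |
|---|---|---|---|---|
| 5 | 11 | 1 | −220 (`h(−55) = 4`) | −30 (`h(−15) = 2`) |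
| 17 | 47 | 5 | −12784 (`h(−799) = 16`) | −102 (`h(−51) = 2`) |
| 41 | 23 | 3 | −15088 (`h(−943) = 16`) | −246 (`h(−123) = 2`) |
| 53 | 11 | 1 | −4664 (`h(−583) = 8`) | −1590 (`h(−159) = 10`) |
| 89 | 11 | 1 | −7832 (`h(−979) = 8`) | −534 (`h(−267) = 2`) |
| 101 | 23 | 3 | −18584 (`h(−2323) = 8`) | −3030 (`h(−303) = 10`) |

(rows generated and cross-checked outside the kernel by this seat's `work/py/qt27_rows.py`: reduced-form class numbers and Jacobi
sums; the identities `S₁ = −qr·h(−qr)`, `S₂ = −3q·h(−3q)` are Dirichlet's class number formula, cf. the tree's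
`norm_bernoulliOneChar_eq_classNumber`, and are NOT used in the kernel — only `3 ∤ S₁`, `3 ∥ S₂` are.)

★ `cruxOnQT27Plus_<q>`: for EVERY globally minimal `W/ℚ` with `C • W = y² = x³ + q·m²` (`qm²` sixth-power-free; `27a^{(q)}` is
`m = 4q`), bad primes `⊂ {3, q}`, `a₂(W) = 0` if `W` is good at `2`, and `r_an(W) ≠ 0`: the CONCLUSION of crux 21381 at `(W, q)` —
`∃ K′` imaginary quadratic, `4 < |d_{K′}|`, Heegner for `N(W)`, `L(W^{(d_{K′})}, 1) ≠ 0`, `q ∤ h(K′)` — MODULO the three named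
facts `hKL` (Kriz–Li 2019 Thm. 1.20), `hGZ` (Gross–Zagier), `hHP` (Heegner-point existence). ★ `cruxBody_on_QT27Plus_five`: the
crux's BODY verbatim at `(W, 5)` (its hypotheses `HasCM`, `r_an = 1`, `5 ≤ q`, `CMInert`, `¬Good`, supply are consumed or idle;
the same one-liner serves every row).

HONEST FRAMING: six cells of ONE CM family; conditional on three REFEREED named facts; the per-curve binders `hW`/`h6`/`h2`/`hS`
stay displayed (as in the cell `bsd-print-cfram`'s class theorems); larger `q` want either bigger `decide`s or the class-number
form of the certificates (Dirichlet's formula, tree `norm_bernoulliOneChar_eq_classNumber` — not bridged here); the crux (C⁺ /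
(S3′)(p) for all `p`), its registered stubs and BSD are NOT proved by any of this. THEOREMS ONLY. Supports stmt-BirchSwinnertonDyer-21381.
[cite: KrizLi2019, Thm. 1.20 (pp. 7–8), §1.5 (1)] [cite: Washington1997, Thm. 4.2] [cite: GrossZagier1986, Thm. I.(6.3), V.§1–2]
[cite: Cox2013, §2.A Thm. 2.13; §7.B Thm. 7.7(ii)] [cite: IrelandRosen1990, Prop. 5.1.2 (Euler's criterion)]
-/

noncomputable section

open scoped Classical

namespace Summit.BirchSwinnertonDyer.BirchSwinnertonDyer.Theorems.KrizLiCornerQT27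

open _root_.WeierstrassCurve NumberField
open Literature.NumberTheory.EllipticCurves Literature.NumberTheory.EllipticCurves.KrizLi2019
  Literature.NumberTheory.EllipticCurves.ModularForms Literature.NumberTheory.QuadraticFields
  Literature.NumberTheory.QuadraticFields.Quadratic
  Summit.BirchSwinnertonDyer.Rank1Residual.X12.O11.RouteU
  Summit.BirchSwinnertonDyer.BirchSwinnertonDyer.Theorems.PrintCFram
/-! ## `(q, r) = (5, 11)` -/
set_option maxRecDepth 200000 in
/-- **CERTIFICATE `3 ∤ S₁(5,11)`**, `S₁ = Σ_{j<55} (j/5)(j/11)·j = -220` (`decide` on Euler's criterion, Jacobi form).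
[cite: KrizLi2019, Thm. 1.20 (p. 8) and §1.5 (1)] [cite: Washington1997, Thm. 4.2] -/
theorem certOne_five_eleven :
    ¬ ((3 : ℤ) ∣ ∑ j ∈ Finset.range (5 * 11),
      jacobiSym (j : ℤ) 5 * jacobiSym (j : ℤ) 11 * (j : ℤ)) := by
  simp_rw [jacobiSym_prime_eq_ite_nat 5 (by norm_num) (by norm_num),
    jacobiSym_prime_eq_ite_nat 11 (by norm_num) (by norm_num)]
  decide +kernel

/-- ★ **The QT27₊ corner at `q = 5`** (certificate `r = 11`, `h(−11) = 1 < 5`): for every globally minimal `W ≅ y² = x³ + 5·m²`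
(`5m²` sixth-power-free; `27a^{(5)}` is `m = 20`) with bad primes `⊂ {3, 5}`, `a₂(W) = 0` if good at `2`, and `r_an(W) ≠ 0`:
the CONCLUSION of crux 21381 at `(W, 5)`, modulo `hKL` (Kriz–Li 1.20), `hGZ` (Gross–Zagier), `hHP` (Heegner points) only.
[cite: KrizLi2019, Thm. 1.20 (pp. 7–8)] [cite: GrossZagier1986, Thm. I.(6.3), V.§1–2] [cite: Cox2013, §7.B Thm. 7.7(ii)] -/
theorem cruxOnQT27Plus_five (hKL : thm120_padicLogHeegner_unit_of_bernoulli)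
    (hGZ : ∀ (N : ℕ) [NeZero N] (W : WeierstrassCurve ℚ) (K : Type) [Field K] [NumberField K], gross_zagier N W K)
    (hHP : ∀ (W : WeierstrassCurve ℚ) (K : Type) [Field K] [NumberField K], exists_isHeegnerPoint W K)
    (W : WeierstrassCurve ℚ) [W.IsElliptic] [W.IsGloballyMinimal] [NeZero (W.conductorNorm ℤ)]
    {m : ℤ} (hm : m ≠ 0) (hW : ∃ C : VariableChange ℚ, C • W = mordellCurve ((5 : ℚ) * (m : ℚ) ^ 2))
    (h6 : ∀ ℓ : ℕ, ℓ.Prime → ¬ ((ℓ : ℤ) ^ 6 ∣ (5 : ℤ) * m ^ 2))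
    (h2 : (haveI : Fact (Nat.Prime 2) := ⟨Nat.prime_two⟩; W.HasGoodReductionAtPrime 2) → W.LFunction 2 = 0)
    (hS : ∀ ℓ : ℕ, (hℓ : ℓ.Prime) → ¬ (haveI := Fact.mk hℓ; W.HasGoodReductionAtPrime ℓ) → ℓ = 3 ∨ ℓ = 5)
    (hr1 : W.analyticRank ≠ 0) :
    ∃ (K : Type) (_ : Field K) (_ : NumberField K),
      IsImaginaryQuadratic K ∧ 4 < (NumberField.discr K).natAbs ∧
      SatisfiesHeegnerHypothesis (W.conductorNorm ℤ) K ∧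
      (W.quadraticTwist (NumberField.discr K : ℚ)).entireLFunction 1 ≠ 0 ∧ ¬ 5 ∣ NumberField.classNumber K := by
  haveI : Fact (Nat.Prime 5) := ⟨by norm_num⟩
  haveI : Fact (Nat.Prime 11) := ⟨by norm_num⟩
  exact exists_cruxConclusion_of_prime_pair hKL hGZ hHP (q := 5) (r := 11) (by norm_num) (by norm_num) (by norm_num)
    (by norm_num) (by norm_num) (by norm_num)
    (by simp_rw [jacobiSym.legendreSym.to_jacobiSym]; exact certOne_five_eleven)
    (by simp_rw [jacobiSym.legendreSym.to_jacobiSym]; exact certTwo_five.1)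
    (by simp_rw [jacobiSym.legendreSym.to_jacobiSym]; exact certTwo_five.2)
    ClassNumberValues.classNumber_neg11 (by norm_num) W hm (by exact_mod_cast hW) (by exact_mod_cast h6) h2
    (fun ℓ hℓ hbad => (hS ℓ hℓ hbad).elim Or.inl fun h => Or.inr (Or.inl h)) hr1

/-- ★ **The crux's BODY verbatim at `(W, 5)` on the QT27₊ class** — `HasCM`, `5 ≤ 5`, `CMInert`, `¬Good` and the supply hypothesis
are idle; `r_an(W) = 1` is used as `r_an(W) ≠ 0`. [cite: KrizLi2019, Thm. 1.20 (pp. 7–8)] [cite: GrossZagier1986, Thm. I.(6.3), V.§1–2] -/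
theorem cruxBody_on_QT27Plus_five (hKL : thm120_padicLogHeegner_unit_of_bernoulli)
    (hGZ : ∀ (N : ℕ) [NeZero N] (W : WeierstrassCurve ℚ) (K : Type) [Field K] [NumberField K], gross_zagier N W K)
    (hHP : ∀ (W : WeierstrassCurve ℚ) (K : Type) [Field K] [NumberField K], exists_isHeegnerPoint W K)
    (W : WeierstrassCurve ℚ) [W.IsElliptic] [W.IsGloballyMinimal] [NeZero (W.conductorNorm ℤ)]
    {m : ℤ} (hm : m ≠ 0) (hW : ∃ C : VariableChange ℚ, C • W = mordellCurve ((5 : ℚ) * (m : ℚ) ^ 2))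
    (h6 : ∀ ℓ : ℕ, ℓ.Prime → ¬ ((ℓ : ℤ) ^ 6 ∣ (5 : ℤ) * m ^ 2))
    (h2 : (haveI : Fact (Nat.Prime 2) := ⟨Nat.prime_two⟩; W.HasGoodReductionAtPrime 2) → W.LFunction 2 = 0)
    (hS : ∀ ℓ : ℕ, (hℓ : ℓ.Prime) → ¬ (haveI := Fact.mk hℓ; W.HasGoodReductionAtPrime ℓ) → ℓ = 3 ∨ ℓ = 5) :
    W.HasCM → W.analyticRank = 1 → 5 ≤ 5 → Rank1Residual.CMInert W 5 → ¬ Rank1Residual.Good W 5 →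
      (∀ B : ℕ, ∃ (K : Type) (_ : Field K) (_ : NumberField K), IsImaginaryQuadratic K ∧ B < (NumberField.discr K).natAbs ∧
        4 < (NumberField.discr K).natAbs ∧ SatisfiesHeegnerHypothesis (W.conductorNorm ℤ) K ∧ ¬ 5 ∣ NumberField.classNumber K) →
      ∃ (K : Type) (_ : Field K) (_ : NumberField K),
        IsImaginaryQuadratic K ∧ 4 < (NumberField.discr K).natAbs ∧
        SatisfiesHeegnerHypothesis (W.conductorNorm ℤ) K ∧
        (W.quadraticTwist (NumberField.discr K : ℚ)).entireLFunction 1 ≠ 0 ∧ ¬ 5 ∣ NumberField.classNumber K :=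
  fun _ hr _ _ _ _ => cruxOnQT27Plus_five hKL hGZ hHP W hm hW h6 h2 hS (by rw [hr]; exact one_ne_zero)

/-! ## `(q, r) = (17, 47)` -/
/-- ★ **The QT27₊ corner at `q = 17`** (certificate `r = 47`, `h(−47) = 5 < 17`): for every globally minimal `W ≅ y² = x³ + 17·m²`
(`17m²` sixth-power-free; `27a^{(17)}` is `m = 68`) with bad primes `⊂ {3, 17}`, `a₂(W) = 0` if good at `2`, and `r_an(W) ≠ 0`:
the CONCLUSION of crux 21381 at `(W, 17)`, modulo `hKL` (Kriz–Li 1.20), `hGZ` (Gross–Zagier), `hHP` (Heegner points) only.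
[cite: KrizLi2019, Thm. 1.20 (pp. 7–8)] [cite: GrossZagier1986, Thm. I.(6.3), V.§1–2] [cite: Cox2013, §7.B Thm. 7.7(ii)] -/
theorem cruxOnQT27Plus_seventeen (hKL : thm120_padicLogHeegner_unit_of_bernoulli)
    (hGZ : ∀ (N : ℕ) [NeZero N] (W : WeierstrassCurve ℚ) (K : Type) [Field K] [NumberField K], gross_zagier N W K)
    (hHP : ∀ (W : WeierstrassCurve ℚ) (K : Type) [Field K] [NumberField K], exists_isHeegnerPoint W K)
    (W : WeierstrassCurve ℚ) [W.IsElliptic] [W.IsGloballyMinimal] [NeZero (W.conductorNorm ℤ)]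
    {m : ℤ} (hm : m ≠ 0) (hW : ∃ C : VariableChange ℚ, C • W = mordellCurve ((17 : ℚ) * (m : ℚ) ^ 2))
    (h6 : ∀ ℓ : ℕ, ℓ.Prime → ¬ ((ℓ : ℤ) ^ 6 ∣ (17 : ℤ) * m ^ 2))
    (h2 : (haveI : Fact (Nat.Prime 2) := ⟨Nat.prime_two⟩; W.HasGoodReductionAtPrime 2) → W.LFunction 2 = 0)
    (hS : ∀ ℓ : ℕ, (hℓ : ℓ.Prime) → ¬ (haveI := Fact.mk hℓ; W.HasGoodReductionAtPrime ℓ) → ℓ = 3 ∨ ℓ = 17)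
    (hr1 : W.analyticRank ≠ 0) :
    ∃ (K : Type) (_ : Field K) (_ : NumberField K),
      IsImaginaryQuadratic K ∧ 4 < (NumberField.discr K).natAbs ∧
      SatisfiesHeegnerHypothesis (W.conductorNorm ℤ) K ∧
      (W.quadraticTwist (NumberField.discr K : ℚ)).entireLFunction 1 ≠ 0 ∧ ¬ 17 ∣ NumberField.classNumber K := by
  haveI : Fact (Nat.Prime 17) := ⟨by norm_num⟩
  haveI : Fact (Nat.Prime 47) := ⟨by norm_num⟩
  exact exists_cruxConclusion_of_prime_pair hKL hGZ hHP (q := 17) (r := 47) (by norm_num) (by norm_num) (by norm_num)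
    (by norm_num) (by norm_num) (by norm_num)
    (by simp_rw [jacobiSym.legendreSym.to_jacobiSym]; exact certOne_seventeen_fortySeven)
    (by simp_rw [jacobiSym.legendreSym.to_jacobiSym]; exact certTwo_seventeen.1)
    (by simp_rw [jacobiSym.legendreSym.to_jacobiSym]; exact certTwo_seventeen.2)
    ClassNumberValues.classNumber_neg47 (by norm_num) W hm (by exact_mod_cast hW) (by exact_mod_cast h6) h2
    (fun ℓ hℓ hbad => (hS ℓ hℓ hbad).elim Or.inl fun h => Or.inr (Or.inl h)) hr1

/-! ## `(q, r) = (41, 23)` -/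
/-- ★ **The QT27₊ corner at `q = 41`** (certificate `r = 23`, `h(−23) = 3 < 41`): for every globally minimal `W ≅ y² = x³ + 41·m²`
(`41m²` sixth-power-free; `27a^{(41)}` is `m = 164`) with bad primes `⊂ {3, 41}`, `a₂(W) = 0` if good at `2`, and `r_an(W) ≠ 0`:
the CONCLUSION of crux 21381 at `(W, 41)`, modulo `hKL` (Kriz–Li 1.20), `hGZ` (Gross–Zagier), `hHP` (Heegner points) only.
[cite: KrizLi2019, Thm. 1.20 (pp. 7–8)] [cite: GrossZagier1986, Thm. I.(6.3), V.§1–2] [cite: Cox2013, §7.B Thm. 7.7(ii)] -/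
theorem cruxOnQT27Plus_fortyOne (hKL : thm120_padicLogHeegner_unit_of_bernoulli)
    (hGZ : ∀ (N : ℕ) [NeZero N] (W : WeierstrassCurve ℚ) (K : Type) [Field K] [NumberField K], gross_zagier N W K)
    (hHP : ∀ (W : WeierstrassCurve ℚ) (K : Type) [Field K] [NumberField K], exists_isHeegnerPoint W K)
    (W : WeierstrassCurve ℚ) [W.IsElliptic] [W.IsGloballyMinimal] [NeZero (W.conductorNorm ℤ)]
    {m : ℤ} (hm : m ≠ 0) (hW : ∃ C : VariableChange ℚ, C • W = mordellCurve ((41 : ℚ) * (m : ℚ) ^ 2))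
    (h6 : ∀ ℓ : ℕ, ℓ.Prime → ¬ ((ℓ : ℤ) ^ 6 ∣ (41 : ℤ) * m ^ 2))
    (h2 : (haveI : Fact (Nat.Prime 2) := ⟨Nat.prime_two⟩; W.HasGoodReductionAtPrime 2) → W.LFunction 2 = 0)
    (hS : ∀ ℓ : ℕ, (hℓ : ℓ.Prime) → ¬ (haveI := Fact.mk hℓ; W.HasGoodReductionAtPrime ℓ) → ℓ = 3 ∨ ℓ = 41)
    (hr1 : W.analyticRank ≠ 0) :
    ∃ (K : Type) (_ : Field K) (_ : NumberField K),
      IsImaginaryQuadratic K ∧ 4 < (NumberField.discr K).natAbs ∧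
      SatisfiesHeegnerHypothesis (W.conductorNorm ℤ) K ∧
      (W.quadraticTwist (NumberField.discr K : ℚ)).entireLFunction 1 ≠ 0 ∧ ¬ 41 ∣ NumberField.classNumber K := by
  haveI : Fact (Nat.Prime 41) := ⟨by norm_num⟩
  haveI : Fact (Nat.Prime 23) := ⟨by norm_num⟩
  exact exists_cruxConclusion_of_prime_pair hKL hGZ hHP (q := 41) (r := 23) (by norm_num) (by norm_num) (by norm_num)
    (by norm_num) (by norm_num) (by norm_num)
    (by simp_rw [jacobiSym.legendreSym.to_jacobiSym]; exact certOne_fortyOne_twentyThree)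
    (by simp_rw [jacobiSym.legendreSym.to_jacobiSym]; exact certTwo_fortyOne.1)
    (by simp_rw [jacobiSym.legendreSym.to_jacobiSym]; exact certTwo_fortyOne.2)
    ClassNumberValues.classNumber_neg23 (by norm_num) W hm (by exact_mod_cast hW) (by exact_mod_cast h6) h2
    (fun ℓ hℓ hbad => (hS ℓ hℓ hbad).elim Or.inl fun h => Or.inr (Or.inl h)) hr1

/-! ## `(q, r) = (53, 11)` -/
set_option maxRecDepth 200000 in
/-- **CERTIFICATE `3 ∤ S₁(53,11)`**, `S₁ = Σ_{j<583} (j/53)(j/11)·j = -4664` (`decide` on Euler's criterion, Jacobi form).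
[cite: KrizLi2019, Thm. 1.20 (p. 8) and §1.5 (1)] [cite: Washington1997, Thm. 4.2] -/
theorem certOne_fiftyThree_eleven :
    ¬ ((3 : ℤ) ∣ ∑ j ∈ Finset.range (53 * 11),
      jacobiSym (j : ℤ) 53 * jacobiSym (j : ℤ) 11 * (j : ℤ)) := by
  simp_rw [jacobiSym_prime_eq_ite_nat 53 (by norm_num) (by norm_num),
    jacobiSym_prime_eq_ite_nat 11 (by norm_num) (by norm_num)]
  decide +kernel

set_option maxRecDepth 200000 in
/-- **CERTIFICATE `3 ∥ S₂(53)`**, `S₂ = Σ_{j<159} (j/53)(j/3)·j = -1590`: `3 ∣ S₂` and `9 ∤ S₂` (`decide`).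
[cite: KrizLi2019, Thm. 1.20 (p. 8) and §1.5 (1)] [cite: Washington1997, Thm. 4.2] -/
theorem certTwo_fiftyThree :
    ((3 : ℤ) ∣ ∑ j ∈ Finset.range (53 * 3),
      jacobiSym (j : ℤ) 53 * jacobiSym (j : ℤ) 3 * (j : ℤ) ^ (0 + 1)) ∧
    ¬ ((3 : ℤ) ^ 2 ∣ ∑ j ∈ Finset.range (53 * 3),
      jacobiSym (j : ℤ) 53 * jacobiSym (j : ℤ) 3 * (j : ℤ) ^ (0 + 1)) := by
  simp_rw [jacobiSym_prime_eq_ite_nat 53 (by norm_num) (by norm_num),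
    jacobiSym_prime_eq_ite_nat 3 (by norm_num) (by norm_num)]
  constructor
  · decide +kernel
  · decide +kernel

/-- ★ **The QT27₊ corner at `q = 53`** (certificate `r = 11`, `h(−11) = 1 < 53`): for every globally minimal `W ≅ y² = x³ + 53·m²`
(`53m²` sixth-power-free; `27a^{(53)}` is `m = 212`) with bad primes `⊂ {3, 53}`, `a₂(W) = 0` if good at `2`, and `r_an(W) ≠ 0`:
the CONCLUSION of crux 21381 at `(W, 53)`, modulo `hKL` (Kriz–Li 1.20), `hGZ` (Gross–Zagier), `hHP` (Heegner points) only.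
[cite: KrizLi2019, Thm. 1.20 (pp. 7–8)] [cite: GrossZagier1986, Thm. I.(6.3), V.§1–2] [cite: Cox2013, §7.B Thm. 7.7(ii)] -/
theorem cruxOnQT27Plus_fiftyThree (hKL : thm120_padicLogHeegner_unit_of_bernoulli)
    (hGZ : ∀ (N : ℕ) [NeZero N] (W : WeierstrassCurve ℚ) (K : Type) [Field K] [NumberField K], gross_zagier N W K)
    (hHP : ∀ (W : WeierstrassCurve ℚ) (K : Type) [Field K] [NumberField K], exists_isHeegnerPoint W K)
    (W : WeierstrassCurve ℚ) [W.IsElliptic] [W.IsGloballyMinimal] [NeZero (W.conductorNorm ℤ)]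
    {m : ℤ} (hm : m ≠ 0) (hW : ∃ C : VariableChange ℚ, C • W = mordellCurve ((53 : ℚ) * (m : ℚ) ^ 2))
    (h6 : ∀ ℓ : ℕ, ℓ.Prime → ¬ ((ℓ : ℤ) ^ 6 ∣ (53 : ℤ) * m ^ 2))
    (h2 : (haveI : Fact (Nat.Prime 2) := ⟨Nat.prime_two⟩; W.HasGoodReductionAtPrime 2) → W.LFunction 2 = 0)
    (hS : ∀ ℓ : ℕ, (hℓ : ℓ.Prime) → ¬ (haveI := Fact.mk hℓ; W.HasGoodReductionAtPrime ℓ) → ℓ = 3 ∨ ℓ = 53)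
    (hr1 : W.analyticRank ≠ 0) :
    ∃ (K : Type) (_ : Field K) (_ : NumberField K),
      IsImaginaryQuadratic K ∧ 4 < (NumberField.discr K).natAbs ∧
      SatisfiesHeegnerHypothesis (W.conductorNorm ℤ) K ∧
      (W.quadraticTwist (NumberField.discr K : ℚ)).entireLFunction 1 ≠ 0 ∧ ¬ 53 ∣ NumberField.classNumber K := by
  haveI : Fact (Nat.Prime 53) := ⟨by norm_num⟩
  haveI : Fact (Nat.Prime 11) := ⟨by norm_num⟩
  exact exists_cruxConclusion_of_prime_pair hKL hGZ hHP (q := 53) (r := 11) (by norm_num) (by norm_num) (by norm_num)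
    (by norm_num) (by norm_num) (by norm_num)
    (by simp_rw [jacobiSym.legendreSym.to_jacobiSym]; exact certOne_fiftyThree_eleven)
    (by simp_rw [jacobiSym.legendreSym.to_jacobiSym]; exact certTwo_fiftyThree.1)
    (by simp_rw [jacobiSym.legendreSym.to_jacobiSym]; exact certTwo_fiftyThree.2)
    ClassNumberValues.classNumber_neg11 (by norm_num) W hm (by exact_mod_cast hW) (by exact_mod_cast h6) h2
    (fun ℓ hℓ hbad => (hS ℓ hℓ hbad).elim Or.inl fun h => Or.inr (Or.inl h)) hr1

/-! ## `(q, r) = (89, 11)` -/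
set_option maxRecDepth 200000 in
/-- **CERTIFICATE `3 ∤ S₁(89,11)`**, `S₁ = Σ_{j<979} (j/89)(j/11)·j = -7832` (`decide` on Euler's criterion, Jacobi form).
[cite: KrizLi2019, Thm. 1.20 (p. 8) and §1.5 (1)] [cite: Washington1997, Thm. 4.2] -/
theorem certOne_eightyNine_eleven :
    ¬ ((3 : ℤ) ∣ ∑ j ∈ Finset.range (89 * 11),
      jacobiSym (j : ℤ) 89 * jacobiSym (j : ℤ) 11 * (j : ℤ)) := by
  simp_rw [jacobiSym_prime_eq_ite_nat 89 (by norm_num) (by norm_num),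
    jacobiSym_prime_eq_ite_nat 11 (by norm_num) (by norm_num)]
  decide +kernel

set_option maxRecDepth 200000 in
/-- **CERTIFICATE `3 ∥ S₂(89)`**, `S₂ = Σ_{j<267} (j/89)(j/3)·j = -534`: `3 ∣ S₂` and `9 ∤ S₂` (`decide`).
[cite: KrizLi2019, Thm. 1.20 (p. 8) and §1.5 (1)] [cite: Washington1997, Thm. 4.2] -/
theorem certTwo_eightyNine :
    ((3 : ℤ) ∣ ∑ j ∈ Finset.range (89 * 3),
      jacobiSym (j : ℤ) 89 * jacobiSym (j : ℤ) 3 * (j : ℤ) ^ (0 + 1)) ∧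
    ¬ ((3 : ℤ) ^ 2 ∣ ∑ j ∈ Finset.range (89 * 3),
      jacobiSym (j : ℤ) 89 * jacobiSym (j : ℤ) 3 * (j : ℤ) ^ (0 + 1)) := by
  simp_rw [jacobiSym_prime_eq_ite_nat 89 (by norm_num) (by norm_num),
    jacobiSym_prime_eq_ite_nat 3 (by norm_num) (by norm_num)]
  constructor
  · decide +kernel
  · decide +kernel

/-- ★ **The QT27₊ corner at `q = 89`** (certificate `r = 11`, `h(−11) = 1 < 89`): for every globally minimal `W ≅ y² = x³ + 89·m²`
(`89m²` sixth-power-free; `27a^{(89)}` is `m = 356`) with bad primes `⊂ {3, 89}`, `a₂(W) = 0` if good at `2`, and `r_an(W) ≠ 0`: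
the CONCLUSION of crux 21381 at `(W, 89)`, modulo `hKL` (Kriz–Li 1.20), `hGZ` (Gross–Zagier), `hHP` (Heegner points) only.
[cite: KrizLi2019, Thm. 1.20 (pp. 7–8)] [cite: GrossZagier1986, Thm. I.(6.3), V.§1–2] [cite: Cox2013, §7.B Thm. 7.7(ii)] -/
theorem cruxOnQT27Plus_eightyNine (hKL : thm120_padicLogHeegner_unit_of_bernoulli)
    (hGZ : ∀ (N : ℕ) [NeZero N] (W : WeierstrassCurve ℚ) (K : Type) [Field K] [NumberField K], gross_zagier N W K)
    (hHP : ∀ (W : WeierstrassCurve ℚ) (K : Type) [Field K] [NumberField K], exists_isHeegnerPoint W K)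
    (W : WeierstrassCurve ℚ) [W.IsElliptic] [W.IsGloballyMinimal] [NeZero (W.conductorNorm ℤ)]
    {m : ℤ} (hm : m ≠ 0) (hW : ∃ C : VariableChange ℚ, C • W = mordellCurve ((89 : ℚ) * (m : ℚ) ^ 2))
    (h6 : ∀ ℓ : ℕ, ℓ.Prime → ¬ ((ℓ : ℤ) ^ 6 ∣ (89 : ℤ) * m ^ 2))
    (h2 : (haveI : Fact (Nat.Prime 2) := ⟨Nat.prime_two⟩; W.HasGoodReductionAtPrime 2) → W.LFunction 2 = 0)
    (hS : ∀ ℓ : ℕ, (hℓ : ℓ.Prime) → ¬ (haveI := Fact.mk hℓ; W.HasGoodReductionAtPrime ℓ) → ℓ = 3 ∨ ℓ = 89)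
    (hr1 : W.analyticRank ≠ 0) :
    ∃ (K : Type) (_ : Field K) (_ : NumberField K),
      IsImaginaryQuadratic K ∧ 4 < (NumberField.discr K).natAbs ∧
      SatisfiesHeegnerHypothesis (W.conductorNorm ℤ) K ∧
      (W.quadraticTwist (NumberField.discr K : ℚ)).entireLFunction 1 ≠ 0 ∧ ¬ 89 ∣ NumberField.classNumber K := by
  haveI : Fact (Nat.Prime 89) := ⟨by norm_num⟩
  haveI : Fact (Nat.Prime 11) := ⟨by norm_num⟩
  exact exists_cruxConclusion_of_prime_pair hKL hGZ hHP (q := 89) (r := 11) (by norm_num) (by norm_num) (by norm_num)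
    (by norm_num) (by norm_num) (by norm_num)
    (by simp_rw [jacobiSym.legendreSym.to_jacobiSym]; exact certOne_eightyNine_eleven)
    (by simp_rw [jacobiSym.legendreSym.to_jacobiSym]; exact certTwo_eightyNine.1)
    (by simp_rw [jacobiSym.legendreSym.to_jacobiSym]; exact certTwo_eightyNine.2)
    ClassNumberValues.classNumber_neg11 (by norm_num) W hm (by exact_mod_cast hW) (by exact_mod_cast h6) h2
    (fun ℓ hℓ hbad => (hS ℓ hℓ hbad).elim Or.inl fun h => Or.inr (Or.inl h)) hr1

/-! ## `(q, r) = (101, 23)` -/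
set_option maxRecDepth 200000 in
/-- **CERTIFICATE `3 ∤ S₁(101,23)`**, `S₁ = Σ_{j<2323} (j/101)(j/23)·j = -18584` (`decide` on Euler's criterion, Jacobi form).
[cite: KrizLi2019, Thm. 1.20 (p. 8) and §1.5 (1)] [cite: Washington1997, Thm. 4.2] -/
theorem certOne_oneHundredOne_twentyThree :
    ¬ ((3 : ℤ) ∣ ∑ j ∈ Finset.range (101 * 23),
      jacobiSym (j : ℤ) 101 * jacobiSym (j : ℤ) 23 * (j : ℤ)) := by
  simp_rw [jacobiSym_prime_eq_ite_nat 101 (by norm_num) (by norm_num),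
    jacobiSym_prime_eq_ite_nat 23 (by norm_num) (by norm_num)]
  decide +kernel

set_option maxRecDepth 200000 in
/-- **CERTIFICATE `3 ∥ S₂(101)`**, `S₂ = Σ_{j<303} (j/101)(j/3)·j = -3030`: `3 ∣ S₂` and `9 ∤ S₂` (`decide`).
[cite: KrizLi2019, Thm. 1.20 (p. 8) and §1.5 (1)] [cite: Washington1997, Thm. 4.2] -/
theorem certTwo_oneHundredOne :
    ((3 : ℤ) ∣ ∑ j ∈ Finset.range (101 * 3),
      jacobiSym (j : ℤ) 101 * jacobiSym (j : ℤ) 3 * (j : ℤ) ^ (0 + 1)) ∧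
    ¬ ((3 : ℤ) ^ 2 ∣ ∑ j ∈ Finset.range (101 * 3),
      jacobiSym (j : ℤ) 101 * jacobiSym (j : ℤ) 3 * (j : ℤ) ^ (0 + 1)) := by
  simp_rw [jacobiSym_prime_eq_ite_nat 101 (by norm_num) (by norm_num),
    jacobiSym_prime_eq_ite_nat 3 (by norm_num) (by norm_num)]
  constructor
  · decide +kernel
  · decide +kernel

/-- ★ **The QT27₊ corner at `q = 101`** (certificate `r = 23`, `h(−23) = 3 < 101`): for every globally minimal `W ≅ y² = x³ + 101·m²`
(`101m²` sixth-power-free; `27a^{(101)}` is `m = 404`) with bad primes `⊂ {3, 101}`, `a₂(W) = 0` if good at `2`, and `r_an(W) ≠ 0`: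
the CONCLUSION of crux 21381 at `(W, 101)`, modulo `hKL` (Kriz–Li 1.20), `hGZ` (Gross–Zagier), `hHP` (Heegner points) only.
[cite: KrizLi2019, Thm. 1.20 (pp. 7–8)] [cite: GrossZagier1986, Thm. I.(6.3), V.§1–2] [cite: Cox2013, §7.B Thm. 7.7(ii)] -/
theorem cruxOnQT27Plus_oneHundredOne (hKL : thm120_padicLogHeegner_unit_of_bernoulli)
    (hGZ : ∀ (N : ℕ) [NeZero N] (W : WeierstrassCurve ℚ) (K : Type) [Field K] [NumberField K], gross_zagier N W K)
    (hHP : ∀ (W : WeierstrassCurve ℚ) (K : Type) [Field K] [NumberField K], exists_isHeegnerPoint W K)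
    (W : WeierstrassCurve ℚ) [W.IsElliptic] [W.IsGloballyMinimal] [NeZero (W.conductorNorm ℤ)]
    {m : ℤ} (hm : m ≠ 0) (hW : ∃ C : VariableChange ℚ, C • W = mordellCurve ((101 : ℚ) * (m : ℚ) ^ 2))
    (h6 : ∀ ℓ : ℕ, ℓ.Prime → ¬ ((ℓ : ℤ) ^ 6 ∣ (101 : ℤ) * m ^ 2))
    (h2 : (haveI : Fact (Nat.Prime 2) := ⟨Nat.prime_two⟩; W.HasGoodReductionAtPrime 2) → W.LFunction 2 = 0)
    (hS : ∀ ℓ : ℕ, (hℓ : ℓ.Prime) → ¬ (haveI := Fact.mk hℓ; W.HasGoodReductionAtPrime ℓ) → ℓ = 3 ∨ ℓ = 101)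
    (hr1 : W.analyticRank ≠ 0) :
    ∃ (K : Type) (_ : Field K) (_ : NumberField K),
      IsImaginaryQuadratic K ∧ 4 < (NumberField.discr K).natAbs ∧
      SatisfiesHeegnerHypothesis (W.conductorNorm ℤ) K ∧
      (W.quadraticTwist (NumberField.discr K : ℚ)).entireLFunction 1 ≠ 0 ∧ ¬ 101 ∣ NumberField.classNumber K := by
  haveI : Fact (Nat.Prime 101) := ⟨by norm_num⟩
  haveI : Fact (Nat.Prime 23) := ⟨by norm_num⟩
  exact exists_cruxConclusion_of_prime_pair hKL hGZ hHP (q := 101) (r := 23) (by norm_num) (by norm_num) (by norm_num)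
    (by norm_num) (by norm_num) (by norm_num)
    (by simp_rw [jacobiSym.legendreSym.to_jacobiSym]; exact certOne_oneHundredOne_twentyThree)
    (by simp_rw [jacobiSym.legendreSym.to_jacobiSym]; exact certTwo_oneHundredOne.1)
    (by simp_rw [jacobiSym.legendreSym.to_jacobiSym]; exact certTwo_oneHundredOne.2)
    ClassNumberValues.classNumber_neg23 (by norm_num) W hm (by exact_mod_cast hW) (by exact_mod_cast h6) h2
    (fun ℓ hℓ hbad => (hS ℓ hℓ hbad).elim Or.inl fun h => Or.inr (Or.inl h)) hr1

end Summit.BirchSwinnertonDyer.BirchSwinnertonDyer.Theorems.KrizLiCornerQT27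

end
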